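import Literature.Barriers.CriticalPhenomena.PlaquetteWalkHoleRootRowLawNoKiss
import Literature.Barriers.CriticalPhenomena.PlaquetteWalkHoleRootForcedFrame
import HarnessLib

/-!
# Barrier catalogue (SAWScalingLimit): the CENSUS CLASSES of the wound cost-`5` members at a root-row rhombus, UNCONDITIONAL («CENSUS CLASSES»)

`Z → ∞` limit model of the printed Yang–Baxter weights [GlazmanManolescu2019, §1, eq. (1)]; the «RECTANGLE COEFFICIENT» line of the venture lane
«pcv-sawmu» (b-engine-1 g23–g26). The class theorems of the line — `PlaquetteWalkHoleRootChirality.chirality_of_cost_five`,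
`PlaquetteWalkHoleRootRowClasses.classes_of_cost_five` / `rowCoherent_of_cost_five`, `PlaquetteWalkHoleRootExtensionClasses.classes_of_cost_seven_east`,
`PlaquetteWalkHoleRootForcedFrame.forced_frame_of_isolated_first_turn` — were proved under the hypotheses «injective plaquette map» and
«straight prefix» / «isolated first turn». With (R2) (`ΩG.injective_of_cost_five`, `ΩG.injective_of_cost_seven_vert`) and
`PlaquetteWalkHoleRootRowLaw.prefix_straight_of_injective_cost_five` / `…_cost_seven_vert` these hypotheses hold at every root-row rhombus east
of the hole; this file records the UNCONDITIONAL forms: every wound class-`B2a` walk of limit cost `5` at such a rhombus has the census class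
`(S; n_HL, n_VL, n_HR, n_VR) = (S; 3,2,0,0)` or `(N; 0,0,3,2)` (kit j276221: 'as'/'ac' → `S`, 'as'/'ao' → `N`), one chirality, phase index `6`/`0`, the
FORCED FRAME, and the cost-`7` vertical-end `NS` parents have the classes `(3,3,0,0)` / `(0,0,3,3)` (kit j280313).
[GlazmanManolescu2019 §1 Fig. 1, eq. (1), Lemma 2.1, Remark 2.2; Glazman2015WeightedSAW Lemma 3.1 (proof, pp. 6–7)]
-/

noncomputable section

namespace Literature.Probability.RandomPlanarGeometry.SAW.YangBaxter

open Real
open Literature.Barriers.CriticalPhenomena.PlaquetteWalk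

namespace ΩG

variable {D : Set Face} {w r : Face} {ω : ΩG D (w.side .W) r}

/-- ★★ **STRAIGHT PREFIX, UNCONDITIONAL**: a wound class-`B2a` walk of limit cost `5` at a root-row rhombus east of the hole runs straight until its first arc
in `r`. [cite: GlazmanManolescu2019, §1, Fig. 1 and eq. (1); Lemma 2.1] [cite: Glazman2015WeightedSAW, Lemma 3.1 (proof, pp. 6–7)] -/
theorem prefix_straight_of_cost_five_rootRow (hh : holeFaceW w ∉ D) (hr : RootedFace D (w.side .W) r) (h : ω.IsB2a)
    (hA : ω.AJ hr h (toC (midPt (w.side .W))) ≠ 0) (hc : cost (slotOfSide ω.1) ω.2.mids = 5) (hrow : r.2 = w.2) (hcol : w.1 ≤ r.1) :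
    ∀ i < ω.2.firstHitG, arcKind (ω.2.sIn i) (ω.2.sOut i) = .straight :=
  prefix_straight_of_injective_cost_five hh hr h hA hc hrow (injective_of_cost_five hh hr h hA hc hrow hcol)

/-- ★★★ **THE CENSUS CLASSES AT LIMIT COST `5`, UNCONDITIONAL**: no `w₁`/`w₂` plaquette, and `(ω.1; n_HL, n_VL, n_HR, n_VR) = (S; 3,2,0,0)` or `(N; 0,0,3,2)`.
[cite: GlazmanManolescu2019, §1, Fig. 1 and eq. (1); Lemma 2.1; Remark 2.2] [cite: Glazman2015WeightedSAW, Lemma 3.1 (proof, pp. 6–7)] -/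
theorem classes_of_cost_five_rootRow (hh : holeFaceW w ∉ D) (hr : RootedFace D (w.side .W) r) (h : ω.IsB2a)
    (hA : ω.AJ hr h (toC (midPt (w.side .W))) ≠ 0) (hc : cost (slotOfSide ω.1) ω.2.mids = 5) (hrow : r.2 = w.2) (hcol : w.1 ≤ r.1) :
    cfgCount ω.2.mids [.corner, .corner] = 0 ∧ cfgCount ω.2.mids [.coCorner, .coCorner] = 0 ∧
      ((ω.1 = .S ∧ hlCount ω.2.mids = 3 ∧ vlCount ω.2.mids = 2 ∧ hrCount ω.2.mids = 0 ∧ vrCount ω.2.mids = 0) ∨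
        (ω.1 = .N ∧ hlCount ω.2.mids = 0 ∧ vlCount ω.2.mids = 0 ∧ hrCount ω.2.mids = 3 ∧ vrCount ω.2.mids = 2)) :=
  classes_of_cost_five hh hr h hA hc (injective_of_cost_five hh hr h hA hc hrow hcol) (prefix_straight_of_cost_five_rootRow hh hr h hA hc hrow hcol)

/-- ★★★ **ONE CHIRALITY, UNCONDITIONAL**: every turning arc turns left (end on `S`) or every turning arc turns right (end on `N`).
[cite: GlazmanManolescu2019, §1, Fig. 1 and eq. (1); Lemma 2.1] [cite: Glazman2015WeightedSAW, Lemma 3.1 (proof, pp. 6–7)] -/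
theorem chirality_of_cost_five_rootRow (hh : holeFaceW w ∉ D) (hr : RootedFace D (w.side .W) r) (h : ω.IsB2a)
    (hA : ω.AJ hr h (toC (midPt (w.side .W))) ≠ 0) (hc : cost (slotOfSide ω.1) ω.2.mids = 5) (hrow : r.2 = w.2) (hcol : w.1 ≤ r.1) :
    (ω.1 = .S ∧ ∀ p ∈ ω.2.arcs, qTurnOf p ≠ 0 → qTurnOf p = 1) ∨ (ω.1 = .N ∧ ∀ p ∈ ω.2.arcs, qTurnOf p ≠ 0 → qTurnOf p = -1) :=
  chirality_of_cost_five hh hr h hA hc (injective_of_cost_five hh hr h hA hc hrow hcol) (prefix_straight_of_cost_five_rootRow hh hr h hA hc hrow hcol)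

/-- ★★★ **ROW-COHERENT WITH PHASE INDEX `6` / `0`, UNCONDITIONAL.** [cite: GlazmanManolescu2019, §1, Fig. 1 and eq. (1); Lemma 2.1, eq. (CR)]
[cite: Glazman2015WeightedSAW, Lemma 3.1 (proof, pp. 6–7)] -/
theorem rowCoherent_of_cost_five_rootRow (hh : holeFaceW w ∉ D) (hr : RootedFace D (w.side .W) r) (h : ω.IsB2a)
    (hA : ω.AJ hr h (toC (midPt (w.side .W))) ≠ 0) (hc : cost (slotOfSide ω.1) ω.2.mids = 5) (hrow : r.2 = w.2) (hcol : w.1 ≤ r.1) :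
    RowCoherent (slotOfSide ω.1) ω.2.mids ∧ ((ω.1 = .S ∧ phaseIndex ω.2.mids = 6) ∨ (ω.1 = .N ∧ phaseIndex ω.2.mids = 0)) :=
  rowCoherent_of_cost_five hh hr h hA hc (injective_of_cost_five hh hr h hA hc hrow hcol) (prefix_straight_of_cost_five_rootRow hh hr h hA hc hrow hcol)

/-- ★★★ **THE COST-`7` PARENTS, UNCONDITIONAL**: a wound class-`B2a` walk of limit cost `7` ending on the `E` side of a root-row rhombus east of the hole with a
turning first arc has no `w₁`/`w₂` plaquette and the classes `(z₁; n_HL, n_VL, n_HR, n_VR) = (N; 3,3,0,0)` or `(S; 0,0,3,3)`.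
[cite: GlazmanManolescu2019, §1, Fig. 1 and eq. (1); Lemma 2.1 (proof: the groups); Remark 2.2] [cite: Glazman2015WeightedSAW, Lemma 3.1 (proof, pp. 6–7)] -/
theorem classes_of_cost_seven_east_rootRow (hh : holeFaceW w ∉ D) (hr : RootedFace D (w.side .W) r) (h : ω.IsB2a)
    (hA : ω.AJ hr h (toC (midPt (w.side .W))) ≠ 0) (hE : ω.1 = .E) (hc : cost (slotOfSide ω.1) ω.2.mids = 7)
    (hNS : arcKind (ω.2.sIn ω.2.firstHitG) (ω.2.sOut ω.2.firstHitG) ≠ .straight) (hrow : r.2 = w.2) (hcol : w.1 ≤ r.1) :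
    cfgCount ω.2.mids [.corner, .corner] = 0 ∧ cfgCount ω.2.mids [.coCorner, .coCorner] = 0 ∧
      ((ω.z1 hr h = .N ∧ hlCount ω.2.mids = 3 ∧ vlCount ω.2.mids = 3 ∧ hrCount ω.2.mids = 0 ∧ vrCount ω.2.mids = 0) ∨
        (ω.z1 hr h = .S ∧ hlCount ω.2.mids = 0 ∧ vlCount ω.2.mids = 0 ∧ hrCount ω.2.mids = 3 ∧ vrCount ω.2.mids = 3)) :=
  have hinj := injective_of_cost_seven_vert hh hr h hA hc (Or.inl hE) hNS hrow hcol
  classes_of_cost_seven_east hh hr h hA hE hc hinj (prefix_straight_of_injective_cost_seven_vert hh hr h hA (Or.inl hE) hc hNS hrow hinj)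

/-- ★★★ **THE FORCED FRAME, UNCONDITIONAL**: a wound class-`B2a` walk of limit cost `5` at a root-row rhombus east of the hole has a first turning arc `k₁`, which is
isolated, and the walk is the forced frame of `forced_frame_of_isolated_first_turn` up to its fifth isolated turn — after which it never turns again.
[cite: GlazmanManolescu2019, §1, Fig. 1 and eq. (1); Lemma 2.1; Remark 2.2] [cite: Glazman2015WeightedSAW, Lemma 3.1 (proof, pp. 6–7)] -/
theorem forced_frame_of_cost_five_rootRow (hh : holeFaceW w ∉ D) (hr : RootedFace D (w.side .W) r) (h : ω.IsB2a)
    (hA : ω.AJ hr h (toC (midPt (w.side .W))) ≠ 0) (hc : cost (slotOfSide ω.1) ω.2.mids = 5) (hrow : r.2 = w.2) (hcol : w.1 ≤ r.1) :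
    ∃ k₁ t : ℕ, k₁ < t ∧ t < ω.2.arcs.length ∧ (∀ i < k₁, arcKind (ω.2.sIn i) (ω.2.sOut i) = .straight) ∧
      (∃ X' Y Y' : ℤ, w.1 ≤ X' ∧ Y' < w.2 ∧ w.2 < Y ∧ (∀ j < ω.2.arcs.length, (ω.2.fc j).1 ≤ X' ∧ Y' ≤ (ω.2.fc j).2 ∧ (ω.2.fc j).2 ≤ Y) ∧
        ω.2.fc k₁ = (X', w.2) ∧
        (((ω.2.fc t).2 = Y' ∧ ω.2.sOut t = .N) ∨ ((ω.2.fc t).2 = Y ∧ ω.2.sOut t = .S))) ∧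
      arcKind (ω.2.sIn t) (ω.2.sOut t) ≠ .straight ∧
      (∀ i, t < i → i < ω.2.arcs.length → arcKind (ω.2.sIn i) (ω.2.sOut i) = .straight) := by
  have hinj := injective_of_cost_five hh hr h hA hc hrow hcol
  obtain ⟨k₁, hk₁, hstr, hturn⟩ := exists_first_turn_of_wound hh hr h hA hc
  obtain ⟨t, hkt, ht, hframe, -, hkt', htail⟩ := forced_frame_of_isolated_first_turn hh hr h hA hc hk₁ hstr hturn
    (fun j hj e => hinj j k₁ hj hk₁ e)
  refine ⟨k₁, t, hkt, ht, hstr, hframe, hkt', fun i hti hi => ?_⟩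
  by_contra hk
  obtain ⟨j, hj, hne, he⟩ := htail i hti hi hk
  exact hne (hinj j i hj hi he)

end ΩG

end Literature.Probability.RandomPlanarGeometry.SAW.YangBaxter
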